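import Mathlib
import HarnessLib
import Literature.MathematicalPhysics.QuantumFieldTheory.LatticeGaugeProofs
import Literature.MathematicalPhysics.QuantumFieldTheory.StrongCouplingActivities
import Literature.MathematicalPhysics.QuantumLattice.CPeriodicBoundaryConditions
import Summits.Ventures.LatticeQCDFlow.Exactness.OpenBoundaryTimeReflection

/-!
# Global automorphism symmetry of the weighted Wilson and open-boundary Gibbs laws; charge conjugation of `SU(N)`: `⟨Im tr W⟩ = 0` for every line and plaquette, with open boundaries too

HONEST FRAMING: exact (Metropolis-corrected) sampling algorithms for lattice gauge theory;
figures of merit are autocorrelation/cost numbers at stated couplings and volumes; no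
continuum-physics claim.

Venture `LatticeQCDFlow` (cell pub-lqcd), topic `Exactness`, FANOUT row 21 (`su3-base`: the `SU(3)` baseline and its
`OBC-HMC` arm measure Wilson loops, Polyakov lines and the clover charge).  The THIRD discrete symmetry of the target
laws next to the reflections (`OpenBoundaryTimeReflection`, row 16's `Θ'`) and the axis permutations
(`AxisPermutationSymmetry`): a GLOBAL continuous automorphism `φ : G ≃ₜ* G` of the compact gauge group acting on every
link at once, `(configAut φ U)_e = φ(U_e)`; for `G = SU(N)` and `φ =` entrywise complex conjugation — the Literature's
`suConj N : SU(N) →* SU(N)` (`QuantumLattice/CPeriodicBoundaryConditions`) — this is CHARGE CONJUGATION `U ↦ Ū`.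
WHAT IS ALREADY IN THE TREE: for the TORUS Wilson law the automorphism / charge-conjugation invariance is proved in
`Summits/QuantumFields/GaugeBoot/ConjugationSymmetry` (another summit's cell file, not importable here); §2's torus
statements re-derive it in this file's `configAut` form in a few lines because the open-boundary half needs the same two
ingredients (Mathlib's `MonoidHom.measurePreserving`: a continuous surjective endomorphism of a compact group preserves the
Haar probability measure; `Re tr ρ(φ g) = Re tr ρ(g)`).  NEW WORK of the cell: the invariance of EVERY plaquette-weighted
Wilson action and of the OPEN-BOUNDARY Gibbs law of every direction (the cell's `weightedWilsonAction`, `obcAction`,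
`gibbsProbability`), and the `SU(N)` consequences a run with open OR periodic boundaries can check.  Nothing is cited as
a fact; no number.

## Objects (definitions, bodies given)

* `configAut φ : GaugeConfig d L G ≃ᵐ GaugeConfig d L G` — `U ↦ φ ∘ U` for a continuous automorphism `φ : G ≃ₜ* G`.
* `suConjAut N : SU(N) ≃ₜ* SU(N)` — the Literature's `suConj N` with its continuity and involutivity packaged;
  `configConj N = configAut (suConjAut N)` — charge conjugation of a lattice gauge field.

## What is proved (every `d`, every `L ≥ 1`, every real `β`)

* §1 `plaquetteHolonomy_configAut`, `lineHolonomy_configAut` — holonomies of `φ ∘ U` are `φ` of the holonomies;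
  `weightedWilsonAction_configAut` / `wilsonAction_configAut` / `obcAction_configAut` — EVERY plaquette-weighted Wilson
  action is invariant as soon as `Re tr ρ(φ g) = Re tr ρ(g)` for all `g` (a hypothesis carried explicitly; it holds for
  inner automorphisms by cyclicity, `re_trace_map_eq_of_conj`, and for charge conjugation, `re_trace_fundamentalRep_suConjAut`).
* §2 `haarProbability_map_continuousMulEquiv` (`φ_* Haar = Haar`, compact `G`), `measurePreserving_configAut_piHaar`;
  `wilsonMeasure_map_configAut`, `wilsonExpectation_comp_configAut` (torus; cf. GaugeBoot); **`obcGibbs_map_configAut`**,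
  `measurePreserving_configAut_obcGibbs`, **`obcGibbs_integral_comp_configAut`** — the open-boundary Gibbs law of every
  direction `τ` is invariant under every `Re tr`-preserving global automorphism.
* §3 `SU(N)`: `suConjAut`, `trace_fundamentalRep_suConjAut` (`tr Ā = star (tr A)`),
  `re_/im_trace_fundamentalRep_suConjAut`; `wilsonMeasure_map_configConj`, `wilsonExpectation_comp_configConj`,
  **`obcGibbs_map_configConj`** — CHARGE-CONJUGATION INVARIANCE of the open-boundary `SU(N)` law (and of the torus law).
* §4 Consequences a run can check: for every `SU(N)`-valued function `h` of the field with `h(Ū) = conj (h U)` (every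
  link, every plaquette holonomy, every straight line / Polyakov line `lineHolonomy`, `link_/plaquetteHolonomy_/lineHolonomy_configConj`)
  the observable `Im tr h` is odd (`im_trace_odd_of_configConj_equivariant`), hence **`⟨Im tr h⟩ = 0`** under the torus
  law (`wilsonExpectation_im_trace_eq_zero_of_equivariant`) AND under the open-boundary law of every direction
  (`obcGibbs_im_trace_integral_eq_zero_of_equivariant`); in particular **`⟨Im tr P⟩_OBC = 0` for every straight line of
  the open lattice** (`obcGibbs_im_trace_lineHolonomy_integral_eq_zero`: spatial Polyakov lines, and temporal lines
  through the bulk), `⟨Im tr U_p⟩_OBC = 0` for every plaquette (`obcGibbs_im_trace_plaquette_integral_eq_zero`), and the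
  torus versions `wilsonExpectation_im_trace_lineHolonomy_eq_zero` / `_plaquette_eq_zero` — so a measured `⟨Im tr P⟩ ≠ 0`
  beyond errors in an `SU(3)` run, open or periodic, indicts the sampler or the estimator, never the target.

NOT CLAIMED: anything about `⟨Re tr P⟩` (centre symmetry is a different statement); that the clover charge is odd
under `C` (it is EVEN: `C` does not constrain `⟨q⟩`); general loop words (GaugeBoot's `wordHolonomy` is not in this
venture's vocabulary — §4's abstract `h` covers any equivariant loop functional); numbers.
-/


noncomputable section

namespace Summit.Ventures.LatticeQCDFlow.Exactness

open MeasureTheory Set Function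
open Literature.MathematicalPhysics.QuantumFieldTheory

/-! ## §1 The global action of a continuous automorphism on configurations; invariance of the weighted actions -/

section Aut

variable {d L N : ℕ} {G : Type*} [Group G] [TopologicalSpace G] [MeasurableSpace G] [BorelSpace G] (φ : G ≃ₜ* G)

/-- The global action `U ↦ φ ∘ U` of a continuous automorphism on lattice gauge configurations, as a measurable
equivalence. -/
def configAut : GaugeConfig d L G ≃ᵐ GaugeConfig d L G :=
  MeasurableEquiv.arrowCongr' (Equiv.refl (Edge d L)) φ.toHomeomorph.toMeasurableEquiv

/-- `configAut` evaluated: `(configAut φ U) e = φ (U e)`. -/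
@[simp] theorem configAut_apply (U : GaugeConfig d L G) (e : Edge d L) : configAut φ U e = φ (U e) := rfl

/-- Plaquette holonomies of `φ ∘ U` are `φ` of the plaquette holonomies. -/
theorem plaquetteHolonomy_configAut (U : GaugeConfig d L G) (x : Site d L) (i j : Fin d) :
    plaquetteHolonomy (configAut φ U) x i j = φ (plaquetteHolonomy U x i j) := by
  simp only [plaquetteHolonomy, configAut_apply, map_mul, map_inv]

/-- Straight-line holonomies (in particular Polyakov lines, `n = L`) of `φ ∘ U` are `φ` of those of `U`. -/
theorem lineHolonomy_configAut (U : GaugeConfig d L G) (k : Fin d) (n : ℕ) (y : Site d L) :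
    lineHolonomy (configAut φ U) k n y = φ (lineHolonomy U k n y) := by
  induction n generalizing y with
  | zero => simp [lineHolonomy]
  | succ n ih => simp only [lineHolonomy, configAut_apply, map_mul, ih]

variable (ρ : G →* Matrix (Fin N) (Fin N) ℂ)

variable {φ ρ}

omit [MeasurableSpace G] [BorelSpace G] in
/-- Inner automorphisms preserve `Re tr ρ` (cyclicity of the trace) — the hypothesis
`∀ g, Re tr ρ(φ g) = Re tr ρ(g)` of everything below holds for them, as it does for charge conjugation (§3). -/
theorem re_trace_map_eq_of_conj (g : G) (hφ : ∀ x, φ x = g * x * g⁻¹) (x : G) :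
    (ρ (φ x)).trace.re = (ρ x).trace.re := by
  rw [hφ, map_mul, map_mul, Matrix.trace_mul_cycle, ← map_mul, inv_mul_cancel, map_one, one_mul]

variable [NeZero L]

/-- **Every plaquette-weighted Wilson action is invariant under a `Re tr`-preserving global automorphism.** -/
theorem weightedWilsonAction_configAut (hφ : ∀ g, (ρ (φ g)).trace.re = (ρ g).trace.re) (w : Plaquette d L → ℝ) (U : GaugeConfig d L G) :
    weightedWilsonAction w ρ (configAut φ U) = weightedWilsonAction w ρ U := by
  simp only [weightedWilsonAction, plaquetteHolonomy_configAut, hφ _]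

/-- The Wilson action is invariant under a `Re tr`-preserving global automorphism. -/
theorem wilsonAction_configAut (hφ : ∀ g, (ρ (φ g)).trace.re = (ρ g).trace.re) (U : GaugeConfig d L G) :
    wilsonAction ρ (configAut φ U) = wilsonAction ρ U := by
  simp only [wilsonAction, plaquetteHolonomy_configAut, hφ _]

/-- The open-boundary action of every direction is invariant under a `Re tr`-preserving global automorphism. -/
theorem obcAction_configAut (hφ : ∀ g, (ρ (φ g)).trace.re = (ρ g).trace.re) (τ : Fin d) (U : GaugeConfig d L G) :
    obcAction ρ τ (configAut φ U) = obcAction ρ τ U :=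
  weightedWilsonAction_configAut hφ (obcWeight τ) U

end Aut

/-! ## §2 Haar, Wilson and open-boundary Gibbs laws are invariant -/

section Measures

variable {d L N : ℕ} [NeZero L] {G : Type*} [Group G] [TopologicalSpace G] [IsTopologicalGroup G] [CompactSpace G]
  [MeasurableSpace G] [BorelSpace G] (φ : G ≃ₜ* G) (ρ : G →* Matrix (Fin N) (Fin N) ℂ)

/-- **A continuous automorphism of a compact group preserves its Haar probability measure**: `φ_* Haar = Haar`
(Mathlib's `MonoidHom.measurePreserving`: continuous, surjective, equal total masses). -/
theorem haarProbability_map_continuousMulEquiv : (haarProbability G).map φ = haarProbability G :=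
  (φ.toMulEquiv.toMonoidHom.measurePreserving φ.continuous φ.surjective rfl).map_eq

/-- The product Haar law of the links is invariant under the global action `U ↦ φ ∘ U`. -/
theorem measurePreserving_configAut_piHaar :
    MeasurePreserving (configAut (d := d) (L := L) φ) (Measure.pi fun _ : Edge d L => haarProbability G)
      (Measure.pi fun _ : Edge d L => haarProbability G) :=
  measurePreserving_arrowCongr' (fun _ : Edge d L => haarProbability G) (fun _ : Edge d L => haarProbability G)
    (Equiv.refl (Edge d L)) φ.toHomeomorph.toMeasurableEquiv fun _ =>
      ⟨φ.continuous.measurable, haarProbability_map_continuousMulEquiv φ⟩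

variable {φ ρ}

/-- **THE TORUS WILSON LAW IS INVARIANT UNDER EVERY `Re tr`-PRESERVING GLOBAL AUTOMORPHISM** (compact `G`, every `β`,
`d`, `L ≥ 1`; no continuity of `ρ` needed). -/
theorem wilsonMeasure_map_configAut (hφ : ∀ g, (ρ (φ g)).trace.re = (ρ g).trace.re) (β : ℝ) :
    (wilsonMeasure ρ β).map (configAut φ) = wilsonMeasure (d := d) (L := L) (G := G) ρ β := by
  simp only [wilsonMeasure, Measure.map_smul, wilsonWeight]
  rw [withDensity_map_of_measurableEquiv _ _ _ (measurePreserving_configAut_piHaar (d := d) (L := L) φ).map_eq]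
  intro U
  rw [wilsonAction_configAut hφ]

/-- `configAut φ` preserves the Wilson law. -/
theorem measurePreserving_configAut_wilsonMeasure (hφ : ∀ g, (ρ (φ g)).trace.re = (ρ g).trace.re) (β : ℝ) :
    MeasurePreserving (configAut φ) (wilsonMeasure (d := d) (L := L) ρ β) (wilsonMeasure ρ β) :=
  ⟨MeasurableEquiv.measurable _, wilsonMeasure_map_configAut hφ β⟩

/-- **`⟨F(φ ∘ U)⟩_β = ⟨F⟩_β`** for every observable. -/
theorem wilsonExpectation_comp_configAut (hφ : ∀ g, (ρ (φ g)).trace.re = (ρ g).trace.re) {V : Type*} [NormedAddCommGroup V]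
    [NormedSpace ℝ V] (β : ℝ) (F : GaugeConfig d L G → V) :
    wilsonExpectation ρ β (F ∘ configAut φ) = wilsonExpectation ρ β F := by
  simp only [wilsonExpectation, Function.comp_apply]
  rw [← integral_map_equiv, wilsonMeasure_map_configAut hφ]

/-- **THE OPEN-BOUNDARY GIBBS LAW OF EVERY DIRECTION IS INVARIANT UNDER EVERY `Re tr`-PRESERVING GLOBAL AUTOMORPHISM.** -/
theorem obcGibbs_map_configAut (hφ : ∀ g, (ρ (φ g)).trace.re = (ρ g).trace.re) (τ : Fin d) (β : ℝ) :
    (gibbsProbability (Measure.pi fun _ : Edge d L => haarProbability G) (fun U => Real.exp (-(β * obcAction ρ τ U)))).map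
        (configAut φ) =
      gibbsProbability (Measure.pi fun _ : Edge d L => haarProbability G) (fun U => Real.exp (-(β * obcAction ρ τ U))) := by
  unfold gibbsProbability
  rw [Measure.map_smul]
  congr 1
  exact WilsonGauge.withDensity_map_equiv_of_invariant _ _ _ (measurePreserving_configAut_piHaar (d := d) (L := L) φ).map_eq
    fun U => by beta_reduce; rw [obcAction_configAut hφ τ U]

/-- `configAut φ` preserves the open-boundary Gibbs law. -/
theorem measurePreserving_configAut_obcGibbs (hφ : ∀ g, (ρ (φ g)).trace.re = (ρ g).trace.re) (τ : Fin d) (β : ℝ) :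
    MeasurePreserving (configAut φ)
      (gibbsProbability (Measure.pi fun _ : Edge d L => haarProbability G) (fun U => Real.exp (-(β * obcAction ρ τ U))))
      (gibbsProbability (Measure.pi fun _ : Edge d L => haarProbability G) (fun U => Real.exp (-(β * obcAction ρ τ U)))) :=
  ⟨MeasurableEquiv.measurable _, obcGibbs_map_configAut hφ τ β⟩

/-- **`⟨F(φ ∘ U)⟩_OBC = ⟨F⟩_OBC`** for every observable and every open direction. -/
theorem obcGibbs_integral_comp_configAut (hφ : ∀ g, (ρ (φ g)).trace.re = (ρ g).trace.re) (τ : Fin d) (β : ℝ) {V : Type*}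
    [NormedAddCommGroup V] [NormedSpace ℝ V] (F : GaugeConfig d L G → V) :
    ∫ U, F (configAut φ U) ∂(gibbsProbability
        (Measure.pi fun _ : Edge d L => haarProbability G) (fun U => Real.exp (-(β * obcAction ρ τ U)))) =
      ∫ U, F U ∂(gibbsProbability (Measure.pi fun _ : Edge d L => haarProbability G)
        (fun U => Real.exp (-(β * obcAction ρ τ U)))) :=
  (measurePreserving_configAut_obcGibbs hφ τ β).integral_comp' F

end Measures

/-! ## §3 Charge conjugation of `SU(N)`: the Literature's entrywise conjugation `suConj N` as a continuous involutive automorphism -/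

section SU

open Literature.MathematicalPhysics.QuantumLattice (fundamentalRep suConj suConj_suConj coe_suConj)

variable (N : ℕ)

/-- **Charge conjugation** `A ↦ Ā` — the Literature's `suConj N : SU(N) →* SU(N)` (`CPeriodicBoundaryConditions`) —
packaged as a continuous involutive automorphism of `SU(N)` (continuity: entrywise `conj` is continuous; the same
one-line continuity proof appears in other summits' files, so it is kept inside the definition here). -/
def suConjAut : Matrix.specialUnitaryGroup (Fin N) ℂ ≃ₜ* Matrix.specialUnitaryGroup (Fin N) ℂ :=
  have hc : Continuous (suConj N) := Continuous.subtype_mk (continuous_subtype_val.matrix_map Complex.continuous_conj) _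
  { (suConj N).toMulEquiv (suConj N) (MonoidHom.ext (suConj_suConj N)) (MonoidHom.ext (suConj_suConj N)) with
    continuous_toFun := hc, continuous_invFun := hc }

/-- `suConjAut` is `suConj`. -/
@[simp] theorem suConjAut_apply (A : Matrix.specialUnitaryGroup (Fin N) ℂ) : suConjAut N A = suConj N A := rfl

/-- `tr Ā = star (tr A)` in the fundamental representation. -/
theorem trace_fundamentalRep_suConjAut (A : Matrix.specialUnitaryGroup (Fin N) ℂ) :
    (fundamentalRep (Fin N) (suConjAut N A)).trace = star (fundamentalRep (Fin N) A).trace := by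
  rw [suConjAut_apply]
  change ((A : Matrix (Fin N) (Fin N) ℂ).map (starRingEnd ℂ)).trace = star (A : Matrix (Fin N) (Fin N) ℂ).trace
  simp only [Matrix.trace, Matrix.diag, Matrix.map_apply, star_sum, starRingEnd_apply]

/-- **`Re tr Ā = Re tr A`**: charge conjugation preserves `Re tr` (the hypothesis of §§1–2). -/
theorem re_trace_fundamentalRep_suConjAut (A : Matrix.specialUnitaryGroup (Fin N) ℂ) :
    (fundamentalRep (Fin N) (suConjAut N A)).trace.re = (fundamentalRep (Fin N) A).trace.re := by
  rw [trace_fundamentalRep_suConjAut, Complex.star_def, Complex.conj_re]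

/-- **`Im tr Ā = −Im tr A`**. -/
theorem im_trace_fundamentalRep_suConjAut (A : Matrix.specialUnitaryGroup (Fin N) ℂ) :
    (fundamentalRep (Fin N) (suConjAut N A)).trace.im = -(fundamentalRep (Fin N) A).trace.im := by
  rw [trace_fundamentalRep_suConjAut, Complex.star_def, Complex.conj_im]

variable {d L : ℕ}

/-- **Charge conjugation of a lattice gauge field**: every link conjugated, `(configConj N U)_e = conj (U_e)`. -/
abbrev configConj : GaugeConfig d L (Matrix.specialUnitaryGroup (Fin N) ℂ) ≃ᵐ GaugeConfig d L (Matrix.specialUnitaryGroup (Fin N) ℂ) :=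
  configAut (suConjAut N)

variable [NeZero L]

/-- **THE TORUS `SU(N)` WILSON LAW IS CHARGE-CONJUGATION INVARIANT** (every `β`, `d`, `L ≥ 1`). -/
theorem wilsonMeasure_map_configConj (β : ℝ) :
    (wilsonMeasure (fundamentalRep (Fin N)) β).map (configConj N) =
      wilsonMeasure (d := d) (L := L) (fundamentalRep (Fin N)) β :=
  wilsonMeasure_map_configAut (re_trace_fundamentalRep_suConjAut N) β

/-- **`⟨F(Ū)⟩_β = ⟨F⟩_β`** for every observable of the `SU(N)` theory. -/
theorem wilsonExpectation_comp_configConj {V : Type*} [NormedAddCommGroup V] [NormedSpace ℝ V] (β : ℝ)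
    (F : GaugeConfig d L (Matrix.specialUnitaryGroup (Fin N) ℂ) → V) :
    wilsonExpectation (fundamentalRep (Fin N)) β (F ∘ configConj N) = wilsonExpectation (fundamentalRep (Fin N)) β F :=
  wilsonExpectation_comp_configAut (re_trace_fundamentalRep_suConjAut N) β F

/-- **THE OPEN-BOUNDARY `SU(N)` GIBBS LAW OF EVERY DIRECTION IS CHARGE-CONJUGATION INVARIANT.** -/
theorem obcGibbs_map_configConj (τ : Fin d) (β : ℝ) :
    (gibbsProbability (Measure.pi fun _ : Edge d L => haarProbability (Matrix.specialUnitaryGroup (Fin N) ℂ))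
        (fun U => Real.exp (-(β * obcAction (fundamentalRep (Fin N)) τ U)))).map (configConj N) =
      gibbsProbability (Measure.pi fun _ : Edge d L => haarProbability (Matrix.specialUnitaryGroup (Fin N) ℂ))
        (fun U => Real.exp (-(β * obcAction (fundamentalRep (Fin N)) τ U))) :=
  obcGibbs_map_configAut (re_trace_fundamentalRep_suConjAut N) τ β

end SU

/-! ## §4 What a run can check: `⟨Im tr h⟩ = 0` for every conjugation-equivariant loop (links, plaquettes, Polyakov lines) -/

section ImTrace

open Literature.MathematicalPhysics.QuantumLattice (fundamentalRep suConj)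

variable (N : ℕ) {d L : ℕ}

/-- For a `G`-valued function of the field that is EQUIVARIANT under charge conjugation, `h(Ū) = conj(h(U))` (every link,
every plaquette holonomy, every straight / Polyakov line, every product of such), the observable `Im tr h` is ODD:
`Im tr h(Ū) = −Im tr h(U)`. -/
theorem im_trace_odd_of_configConj_equivariant
    {h : GaugeConfig d L (Matrix.specialUnitaryGroup (Fin N) ℂ) → Matrix.specialUnitaryGroup (Fin N) ℂ}
    (hh : ∀ U, h (configConj N U) = suConjAut N (h U)) (U : GaugeConfig d L (Matrix.specialUnitaryGroup (Fin N) ℂ)) :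
    (fundamentalRep (Fin N) (h (configConj N U))).trace.im = -(fundamentalRep (Fin N) (h U)).trace.im := by
  rw [hh, im_trace_fundamentalRep_suConjAut]

/-- Every single link is conjugation-equivariant (by definition). -/
theorem link_configConj (U : GaugeConfig d L (Matrix.specialUnitaryGroup (Fin N) ℂ)) (e : Edge d L) :
    (fun V : GaugeConfig d L (Matrix.specialUnitaryGroup (Fin N) ℂ) => V e) (configConj N U) = suConjAut N (U e) := rfl

/-- Every plaquette holonomy is conjugation-equivariant. -/
theorem plaquetteHolonomy_configConj (U : GaugeConfig d L (Matrix.specialUnitaryGroup (Fin N) ℂ)) (x : Site d L)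
    (i j : Fin d) : plaquetteHolonomy (configConj N U) x i j = suConjAut N (plaquetteHolonomy U x i j) :=
  plaquetteHolonomy_configAut (suConjAut N) U x i j

/-- Every straight-line holonomy — in particular every Polyakov line (`n = L`) — is conjugation-equivariant. -/
theorem lineHolonomy_configConj (U : GaugeConfig d L (Matrix.specialUnitaryGroup (Fin N) ℂ)) (k : Fin d) (n : ℕ)
    (y : Site d L) : lineHolonomy (configConj N U) k n y = suConjAut N (lineHolonomy U k n y) :=
  lineHolonomy_configAut (suConjAut N) U k n y

variable [NeZero L]

/-- **`⟨Im tr h⟩_β = 0`** under the torus `SU(N)` Wilson law for every conjugation-equivariant `h`. -/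
theorem wilsonExpectation_im_trace_eq_zero_of_equivariant (β : ℝ)
    {h : GaugeConfig d L (Matrix.specialUnitaryGroup (Fin N) ℂ) → Matrix.specialUnitaryGroup (Fin N) ℂ}
    (hh : ∀ U, h (configConj N U) = suConjAut N (h U)) :
    wilsonExpectation (fundamentalRep (Fin N)) β
      (fun U : GaugeConfig d L (Matrix.specialUnitaryGroup (Fin N) ℂ) => (fundamentalRep (Fin N) (h U)).trace.im) = 0 := by
  have key := wilsonExpectation_comp_configConj N (d := d) (L := L) β
    (fun U : GaugeConfig d L (Matrix.specialUnitaryGroup (Fin N) ℂ) => (fundamentalRep (Fin N) (h U)).trace.im)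
  have hodd : (fun U : GaugeConfig d L (Matrix.specialUnitaryGroup (Fin N) ℂ) => (fundamentalRep (Fin N) (h U)).trace.im) ∘
      configConj N = fun U => -(fundamentalRep (Fin N) (h U)).trace.im := by
    funext U
    simp only [Function.comp_apply, im_trace_odd_of_configConj_equivariant N hh U]
  rw [hodd] at key
  unfold wilsonExpectation at key ⊢
  rw [integral_neg] at key
  linarith

/-- **`⟨Im tr h⟩_OBC = 0`** under the open-boundary `SU(N)` Gibbs law of every direction, for every conjugation-equivariant `h`. -/
theorem obcGibbs_im_trace_integral_eq_zero_of_equivariant (τ : Fin d) (β : ℝ)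
    {h : GaugeConfig d L (Matrix.specialUnitaryGroup (Fin N) ℂ) → Matrix.specialUnitaryGroup (Fin N) ℂ}
    (hh : ∀ U, h (configConj N U) = suConjAut N (h U)) :
    ∫ U, (fundamentalRep (Fin N) (h U)).trace.im ∂(gibbsProbability
        (Measure.pi fun _ : Edge d L => haarProbability (Matrix.specialUnitaryGroup (Fin N) ℂ))
        (fun U => Real.exp (-(β * obcAction (fundamentalRep (Fin N)) τ U)))) = 0 := by
  have key := obcGibbs_integral_comp_configAut (re_trace_fundamentalRep_suConjAut N) τ β
    (fun U : GaugeConfig d L (Matrix.specialUnitaryGroup (Fin N) ℂ) => (fundamentalRep (Fin N) (h U)).trace.im)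
  simp only [im_trace_odd_of_configConj_equivariant N hh, integral_neg] at key
  linarith

/-- **`⟨Im tr U_p⟩_β = 0` for every plaquette.** -/
theorem wilsonExpectation_im_trace_plaquette_eq_zero (β : ℝ) (x : Site d L) (i j : Fin d) :
    wilsonExpectation (fundamentalRep (Fin N)) β
      (fun U : GaugeConfig d L (Matrix.specialUnitaryGroup (Fin N) ℂ) =>
        (fundamentalRep (Fin N) (plaquetteHolonomy U x i j)).trace.im) = 0 :=
  wilsonExpectation_im_trace_eq_zero_of_equivariant N β fun U => plaquetteHolonomy_configConj N U x i j

/-- **`⟨Im tr P⟩_β = 0` FOR EVERY STRAIGHT LINE, IN PARTICULAR EVERY POLYAKOV LINE** (`n = L`: the closed line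
winding once around direction `k` through `y`) of the torus `SU(N)` theory, at every `β` and every volume. -/
theorem wilsonExpectation_im_trace_lineHolonomy_eq_zero (β : ℝ) (k : Fin d) (n : ℕ) (y : Site d L) :
    wilsonExpectation (fundamentalRep (Fin N)) β
      (fun U : GaugeConfig d L (Matrix.specialUnitaryGroup (Fin N) ℂ) =>
        (fundamentalRep (Fin N) (lineHolonomy U k n y)).trace.im) = 0 :=
  wilsonExpectation_im_trace_eq_zero_of_equivariant N β fun U => lineHolonomy_configConj N U k n y

/-- **`⟨Im tr P⟩_OBC = 0`** for every straight line of the open lattice (e.g. a spatial Polyakov line, or the temporal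
line through the bulk), every open direction `τ`, every `β`. -/
theorem obcGibbs_im_trace_lineHolonomy_integral_eq_zero (τ : Fin d) (β : ℝ) (k : Fin d) (n : ℕ) (y : Site d L) :
    ∫ U, (fundamentalRep (Fin N) (lineHolonomy U k n y)).trace.im ∂(gibbsProbability
        (Measure.pi fun _ : Edge d L => haarProbability (Matrix.specialUnitaryGroup (Fin N) ℂ))
        (fun U => Real.exp (-(β * obcAction (fundamentalRep (Fin N)) τ U)))) = 0 :=
  obcGibbs_im_trace_integral_eq_zero_of_equivariant N τ β fun U => lineHolonomy_configConj N U k n y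

/-- **`⟨Im tr U_p⟩_OBC = 0`** for every plaquette of the open lattice. -/
theorem obcGibbs_im_trace_plaquette_integral_eq_zero (τ : Fin d) (β : ℝ) (x : Site d L) (i j : Fin d) :
    ∫ U, (fundamentalRep (Fin N) (plaquetteHolonomy U x i j)).trace.im ∂(gibbsProbability
        (Measure.pi fun _ : Edge d L => haarProbability (Matrix.specialUnitaryGroup (Fin N) ℂ))
        (fun U => Real.exp (-(β * obcAction (fundamentalRep (Fin N)) τ U)))) = 0 :=
  obcGibbs_im_trace_integral_eq_zero_of_equivariant N τ β fun U => plaquetteHolonomy_configConj N U x i j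

end ImTrace

end Summit.Ventures.LatticeQCDFlow.Exactness
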